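import Literature.Computability.Complexity.KnapsackSosDegree
import Literature.Computability.Complexity.SumOfSquaresRefutationDuality
import HarnessLib

/-!
# Grigoriev's knapsack pseudo-expectation and the SOS degree lower bound `≥ 2k + 4`
# (Grigoriev 2001, Theorem (i))

Source: D. Grigoriev, *Complexity of Positivstellensatz proofs for the knapsack*, comput. complexity 10
(2001) 139–154 [Grigoriev2001] (held: `paper:doi-10-1007-s00037-001-8192-0`, PDF pages as locators),
the knapsack system (0.7) `f = X_1 + ⋯ + X_n − r = 0`, `f_i = X_i² − X_i = 0`, and

> **Theorem** (PDF p. 6). Let `k` be a non-negative integer and suppose that `k < r < n − k`.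
> (i) When `0 ≤ k ≤ (n−3)/2` the Positivstellensatz refutation degree of (0.7) is greater or equal
> to `2k + 4`.

whose proof (PDF pp. 8–9) applies the linear functional `B` (`B(X_I) = B_k` for `|I| = k`, extended to
`ℝ[X]` through the multilinear quotient `A = ℝ[X]/(X_i² − X_i)`) to a refutation
`1 + Σ h_j² = Σ f_i g_i + f g`: the right-hand side vanishes by **Lemma 1.3** (`B(f g') = 0` for
`deg g' < n`) and `B(f_i g_i) = B(0̄) = 0`, while `B(h_j²) = h_j Q_{⌊d/2⌋} h_jᵀ ≥ 0` by **Lemma 1.4** and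
`B(1) = 1`. This file builds `B` as a linear functional on `MvPolynomial (Fin n) ℝ`
(`Knapsack.functional`), proves the four properties — `B(1) = 1`, Booleanity
`B((X_i² − X_i) g) = 0`, Lemma 1.3 `B((Σ X_i − r) g) = 0` for `deg g < n`, and
`B(q²) = knapsackForm n r h ≥ 0` for `deg q ≤ l`, `2l ≤ n`, `l − 1 < r < n − l + 1` (from the tree's
PROVED Lemma 1.4, `Grigoriev2001_knapsackFormNonneg_holds`) — packages them as a pseudo-expectation
(`Knapsack.exists_pseudoexpectation`, the shape in which SOS lower bounds are consumed, cf. the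
identical "four observations about `G_r`" of Lee–Prakash–de Wolf–Yuen [LeePrakashDewolfYuen2016,
App. C]), and concludes **Theorem (i)** in the tree's static-SOS currency by weak duality
(`not_hasSOSRefutation_of_functional'`, `SumOfSquaresRefutationDuality.lean`):
`Knapsack.not_hasSOSRefutation` — no `HasSOSRefutation (Knapsack.system n r) d` for `2d ≤ n`,
`d − 1 < r < n − d + 1` — and the printed parametrisation `Knapsack.not_hasSOSRefutation_succ`
(`d = k + 1`, `k < r < n − k`, `2k + 2 ≤ n`; Grigoriev's `k ≤ (n−3)/2` is contained).

Degree dictionary (as in `KnapsackSosDegree.lean`): the tree's `HasSOSRefutation S d` has squares of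
polynomials of degree `≤ d` and products `g_e · S e` of degree `≤ 2d`, i.e. Grigoriev–Vorobjov
refutation degree `≤ 2d`; "refutation degree `≥ 2k + 4`" is `¬ HasSOSRefutation _ (k + 1)`.
The bound is TIGHT (refutations of degree `2k + 4` exist): Lee–Prakash–de Wolf–Yuen, CCC 2016,
Thm. 4.3 [LeePrakashDewolfYuen2016] — not formalised here. Everything below is PROVED (no facts,
standard axioms); the only definitions are the system, the functional and the multilinear
coefficient vector `mlCoeff`.
-/

noncomputable section

open MvPolynomial Finset

namespace Literature.Computability.Complexity

namespace Knapsack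

variable {n : ℕ}

/-- **The knapsack system (0.7)**: the equations `X_1 + ⋯ + X_n − r = 0` (index `none`) and
`X_i² − X_i = 0` (index `some i`). [cite: Grigoriev2001, (0.7) (PDF p. 5)] -/
def system (n : ℕ) (r : ℝ) : Option (Fin n) → MvPolynomial (Fin n) ℝ
  | none => (∑ i : Fin n, X i) - C r
  | some i => X i ^ 2 - X i

/-- The knapsack equation `X_1 + ⋯ + X_n − r`. [cite: Grigoriev2001, (0.7) (PDF p. 5)] -/
@[simp] theorem system_none (r : ℝ) : system n r none = (∑ i : Fin n, X i) - C r := rfl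

/-- The Booleanity equations `X_i² − X_i`. [cite: Grigoriev2001, (0.7) (PDF p. 5)] -/
@[simp] theorem system_some (r : ℝ) (i : Fin n) : system n r (some i) = X i ^ 2 - X i := rfl

/-- **Grigoriev's functional `B`** on `ℝ[X_1,…,X_n]`: the linear functional with
`B(X^α) = B_{|supp α|}(r)` (a monomial is first reduced to its multilinear representative
`X_{supp α}` in `A = ℝ[X]/(X_i² − X_i)`, then `B(X_I) = B_{|I|}`).
[cite: Grigoriev2001, §1 (definition of B and its extension to ℝ[X], PDF p. 8)] -/
def functional (n : ℕ) (r : ℝ) : MvPolynomial (Fin n) ℝ →ₗ[ℝ] ℝ :=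
  Finsupp.linearCombination ℝ (fun α : Fin n →₀ ℕ => knapsackMoment n r α.support.card) ∘ₗ
    (AddMonoidAlgebra.coeffLinearEquiv ℝ : AddMonoidAlgebra ℝ (Fin n →₀ ℕ) ≃ₗ[ℝ] _).toLinearMap

/-- Value on a monomial: `B(c X^α) = c · B_{|supp α|}`. [cite: Grigoriev2001, §1 (PDF p. 8)] -/
theorem functional_monomial (r : ℝ) (α : Fin n →₀ ℕ) (c : ℝ) :
    functional n r (monomial α c) = c * knapsackMoment n r α.support.card := by
  simp [functional, monomial]

/-- `B(1) = B_0 = 1`. [cite: Grigoriev2001, §1 ("B(1) = B_0 = 1", PDF p. 8)] -/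
theorem functional_one (r : ℝ) : functional n r 1 = 1 := by
  rw [show (1 : MvPolynomial (Fin n) ℝ) = monomial 0 1 from rfl, functional_monomial]
  simp

/-- Value on a product, monomial by monomial. [cite: Grigoriev2001, §1 (PDF p. 8)] -/
theorem functional_mul (r : ℝ) (p q : MvPolynomial (Fin n) ℝ) :
    functional n r (p * q) = ∑ α ∈ p.support, ∑ β ∈ q.support,
      coeff α p * coeff β q * knapsackMoment n r (α + β).support.card := by
  classical
  conv_lhs => rw [p.as_sum, q.as_sum, sum_mul]
  rw [map_sum]
  refine sum_congr rfl fun α _ => ?_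
  rw [mul_sum, map_sum]
  refine sum_congr rfl fun β _ => ?_
  rw [monomial_mul, functional_monomial]

/-- Supports add as unions for exponent vectors. [folklore] -/
private theorem support_add_eq_union (α β : Fin n →₀ ℕ) : (α + β).support = α.support ∪ β.support := by
  ext i
  simp only [Finsupp.mem_support_iff, Finsupp.add_apply, ne_eq, Nat.add_eq_zero_iff, mem_union]
  tauto

/-- The number of variables of a monomial is at most its degree, hence at most the total degree
of any polynomial containing it. [folklore] -/
private theorem card_support_le_totalDegree {p : MvPolynomial (Fin n) ℝ} {α : Fin n →₀ ℕ}
    (hα : α ∈ p.support) : α.support.card ≤ p.totalDegree := by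
  refine le_trans ?_ (le_totalDegree hα)
  rw [Finsupp.sum, Finset.card_eq_sum_ones]
  exact Finset.sum_le_sum fun i hi => Nat.one_le_iff_ne_zero.mpr (Finsupp.mem_support_iff.mp hi)

/-! ### The functional vanishes on the ideal (Lemma 1.3 and Booleanity) -/

/-- **Booleanity**: `B((X_i² − X_i) · g) = 0` for every `g` (the functional factors through
`A = ℝ[X]/(X_i² − X_i)`). [cite: Grigoriev2001, §1 ("extend B to all of ℝ[X] by B(g) = B(ḡ)", PDF p. 8)] -/
theorem functional_bool_mul (r : ℝ) (i : Fin n) (g : MvPolynomial (Fin n) ℝ) :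
    functional n r ((X i ^ 2 - X i) * g) = 0 := by
  classical
  conv_lhs => rw [g.as_sum, mul_sum]
  rw [map_sum]
  refine sum_eq_zero fun β _ => ?_
  have hX : (X i : MvPolynomial (Fin n) ℝ) = monomial (Finsupp.single i 1) 1 := rfl
  have hX2 : (X i ^ 2 : MvPolynomial (Fin n) ℝ) = monomial (Finsupp.single i 2) 1 := by
    rw [hX, monomial_pow]; simp
  rw [sub_mul, hX2, hX, monomial_mul, monomial_mul, map_sub, functional_monomial, functional_monomial,
    support_add_eq_union, support_add_eq_union, Finsupp.support_single _ two_ne_zero,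
    Finsupp.support_single _ one_ne_zero, sub_self]

/-- **Lemma 1.3 on monomials**: `B((Σ_j X_j − r) · c X^β) = c · ((n − k) B_{k+1} + (k − r) B_k) = 0`
for `k = |supp β| < n`. [cite: Grigoriev2001, Lemma 1.3 (PDF p. 8)] -/
theorem functional_knapsack_mul_monomial (r : ℝ) {β : Fin n →₀ ℕ} (hβ : β.support.card < n) (c : ℝ) :
    functional n r (((∑ j : Fin n, X j) - C r) * monomial β c) = 0 := by
  classical
  set k := β.support.card with hk
  have hX : ∀ j : Fin n, (X j : MvPolynomial (Fin n) ℝ) = monomial (Finsupp.single j 1) 1 := fun j => rfl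
  have hsum : functional n r ((∑ j : Fin n, X j) * monomial β c) =
      c * ((k : ℝ) * knapsackMoment n r k + ((n : ℝ) - k) * knapsackMoment n r (k + 1)) := by
    rw [sum_mul, map_sum]
    simp_rw [hX, monomial_mul, functional_monomial, one_mul, support_add_eq_union,
      Finsupp.support_single _ one_ne_zero]
    -- split the sum over `j ∈ supp β` (union = supp β) and `j ∉ supp β` (one more element)
    rw [← mul_sum, ← sum_filter_add_sum_filter_not univ (fun j => j ∈ β.support)]
    congr 1
    have h1 : ∀ j ∈ univ.filter (fun j => j ∈ β.support),
        knapsackMoment n r ({j} ∪ β.support).card = knapsackMoment n r k := by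
      intro j hj
      rw [mem_filter] at hj
      rw [show ({j} ∪ β.support) = β.support from
        union_eq_right.2 (singleton_subset_iff.2 hj.2)]
    have h2 : ∀ j ∈ univ.filter (fun j => j ∉ β.support),
        knapsackMoment n r ({j} ∪ β.support).card = knapsackMoment n r (k + 1) := by
      intro j hj
      rw [mem_filter] at hj
      rw [singleton_union, card_insert_of_notMem hj.2]
    rw [sum_congr rfl h1, sum_congr rfl h2, sum_const, sum_const, nsmul_eq_mul, nsmul_eq_mul]
    have hc1 : (univ.filter (fun j : Fin n => j ∈ β.support)).card = k := by
      rw [hk]; congr 1; ext j; simp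
    have hc2 : (univ.filter (fun j : Fin n => j ∉ β.support)).card = n - k := by
      have := card_filter_add_card_filter_not (s := (univ : Finset (Fin n)))
        (fun j : Fin n => j ∈ β.support)
      rw [hc1, card_univ, Fintype.card_fin] at this
      omega
    rw [hc1, hc2, Nat.cast_sub hβ.le]
  rw [sub_mul, map_sub, hsum, C_mul_monomial, functional_monomial, ← hk]
  have hrec := knapsackMoment_recurrence n r hβ
  have : c * ((k : ℝ) * knapsackMoment n r k + ((n : ℝ) - k) * knapsackMoment n r (k + 1)) -
      r * c * knapsackMoment n r k =
      c * (((n : ℝ) - k) * knapsackMoment n r (k + 1) + ((k : ℝ) - r) * knapsackMoment n r k) := by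
    ring
  rw [this, hrec, mul_zero]

/-- **Lemma 1.3**: `B((Σ_j X_j − r) · g) = 0` for every `g` of total degree `< n`.
[cite: Grigoriev2001, Lemma 1.3 (PDF p. 8)] -/
theorem functional_knapsack_mul (r : ℝ) {g : MvPolynomial (Fin n) ℝ} (hg : g.totalDegree < n) :
    functional n r (((∑ j : Fin n, X j) - C r) * g) = 0 := by
  classical
  conv_lhs => rw [g.as_sum, mul_sum]
  rw [map_sum]
  exact sum_eq_zero fun β hβ =>
    functional_knapsack_mul_monomial r ((card_support_le_totalDegree hβ).trans_lt hg) _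

/-! ### Squares: the functional is Grigoriev's quadratic form `Q` -/

/-- The multilinear coefficient vector of `q`: `h_S = Σ_{α : supp α = S} q_α`
(the coefficients of the canonical representative `q̄ ∈ A`). [cite: Grigoriev2001, §1 (PDF p. 8)] -/
def mlCoeff (q : MvPolynomial (Fin n) ℝ) (S : Finset (Fin n)) : ℝ :=
  ∑ α ∈ q.support.filter (fun α => α.support = S), coeff α q

/-- `B(q²) = Q(h, h)` with `h` the multilinear coefficient vector of `q`:
`B(q²) = Σ_{I,J} h_I h_J B_{|I ∪ J|} = knapsackForm n r h`.
[cite: Grigoriev2001, §1 ("B(h_j²) = Σ_{I,J} h^{(I)} h^{(J)} B(X_I X_J) = h_j Q h_jᵀ", PDF p. 9)] -/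
theorem functional_mul_self (r : ℝ) (q : MvPolynomial (Fin n) ℝ) :
    functional n r (q * q) = knapsackForm n r (mlCoeff q) := by
  classical
  rw [functional_mul, knapsackForm]
  symm
  calc ∑ I, ∑ J, mlCoeff q I * mlCoeff q J * knapsackMoment n r (I ∪ J).card
      = ∑ I, ∑ J, ∑ α ∈ q.support.filter (fun α => α.support = I),
          ∑ β ∈ q.support.filter (fun β => β.support = J),
            coeff α q * coeff β q * knapsackMoment n r (α + β).support.card := by
        refine sum_congr rfl fun I _ => sum_congr rfl fun J _ => ?_
        rw [mlCoeff, mlCoeff, sum_mul, sum_mul]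
        refine sum_congr rfl fun α hα => ?_
        rw [mul_sum, sum_mul]
        refine sum_congr rfl fun β hβ => ?_
        rw [support_add_eq_union, (mem_filter.1 hα).2, (mem_filter.1 hβ).2]
    _ = ∑ I, ∑ α ∈ q.support.filter (fun α => α.support = I), ∑ J,
          ∑ β ∈ q.support.filter (fun β => β.support = J),
            coeff α q * coeff β q * knapsackMoment n r (α + β).support.card := by
        refine sum_congr rfl fun I _ => sum_comm
    _ = ∑ α ∈ q.support, ∑ β ∈ q.support,
          coeff α q * coeff β q * knapsackMoment n r (α + β).support.card := by
        rw [sum_fiberwise q.support (fun α => α.support)]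
        refine sum_congr rfl fun α _ => ?_
        rw [sum_fiberwise q.support (fun β => β.support)]

/-- The multilinear coefficient vector of a polynomial of degree `≤ l` lives on sets of size `≤ l`.
[cite: Grigoriev2001, §1 (deg h_j ≤ ⌊d/2⌋, PDF p. 9)] -/
theorem mlCoeff_eq_zero_of_lt {q : MvPolynomial (Fin n) ℝ} {l : ℕ} (hq : q.totalDegree ≤ l)
    {S : Finset (Fin n)} (hS : l < S.card) : mlCoeff q S = 0 := by
  refine sum_eq_zero fun α hα => ?_
  exfalso
  rw [mem_filter] at hα
  have := card_support_le_totalDegree hα.1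
  rw [hα.2] at this
  omega

/-- **Positivity (Lemma 1.4, via its discharge)**: `B(q²) ≥ 0` for `deg q ≤ l`, `2l ≤ n`,
`l − 1 < r < n − l + 1`. [cite: Grigoriev2001, Lemma 1.4 (PDF p. 8)] -/
theorem functional_mul_self_nonneg {l : ℕ} {r : ℝ} (hl : 2 * l ≤ n) (hr₁ : (l : ℝ) - 1 < r)
    (hr₂ : r < (n : ℝ) - l + 1) {q : MvPolynomial (Fin n) ℝ} (hq : q.totalDegree ≤ l) :
    0 ≤ functional n r (q * q) := by
  rw [functional_mul_self]
  exact Grigoriev2001_knapsackFormNonneg_holds n l r hl hr₁ hr₂ _ fun S hS => mlCoeff_eq_zero_of_lt hq hS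

/-! ### The theorems -/

/-- **Grigoriev's knapsack pseudo-expectation.** For `2l ≤ n` and `l − 1 < r < n − l + 1` the
functional `B` is a degree-`2l` pseudo-expectation for the knapsack system: `B(1) = 1`,
`B(q²) ≥ 0` (`deg q ≤ l`), `B((X_i² − X_i) g) = 0` (all `g`), `B((Σ X_i − r) g) = 0` (`deg g < n`).
[cite: Grigoriev2001, Lemmas 1.3–1.4 (PDF p. 8)]
[cite: LeePrakashDewolfYuen2016, App. C (the four observations about G_r; arXiv text chunk 23)] -/
theorem exists_pseudoexpectation {l : ℕ} {r : ℝ} (hl : 2 * l ≤ n) (hr₁ : (l : ℝ) - 1 < r)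
    (hr₂ : r < (n : ℝ) - l + 1) :
    ∃ E : MvPolynomial (Fin n) ℝ →ₗ[ℝ] ℝ, E 1 = 1 ∧
      (∀ q : MvPolynomial (Fin n) ℝ, q.totalDegree ≤ l → 0 ≤ E (q * q)) ∧
      (∀ (i : Fin n) (g : MvPolynomial (Fin n) ℝ), E ((X i ^ 2 - X i) * g) = 0) ∧
      (∀ g : MvPolynomial (Fin n) ℝ, g.totalDegree < n → E (((∑ j : Fin n, X j) - C r) * g) = 0) :=
  ⟨functional n r, functional_one r, fun _ hq => functional_mul_self_nonneg hl hr₁ hr₂ hq,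
    functional_bool_mul r, fun _ hg => functional_knapsack_mul r hg⟩

/-- The knapsack equation has total degree `1` (for `n ≥ 1`). [cite: Grigoriev2001, (0.7) (PDF p. 5)] -/
theorem totalDegree_system_none (hn : 1 ≤ n) (r : ℝ) : (system n r none).totalDegree = 1 := by
  classical
  refine le_antisymm ?_ ?_
  · rw [system_none]
    refine (totalDegree_sub _ _).trans (max_le ?_ (by rw [totalDegree_C]; exact Nat.zero_le _))
    exact (totalDegree_finsetSum _ _).trans (Finset.sup_le fun i _ => (totalDegree_X (R := ℝ) i).le)
  · set i0 : Fin n := ⟨0, hn⟩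
    have hcoeff : coeff (Finsupp.single i0 1) (system n r none) = 1 := by
      rw [system_none, coeff_sub, coeff_sum, coeff_C, if_neg (Finsupp.single_ne_zero.2 one_ne_zero).symm,
        sub_zero]
      rw [sum_eq_single_of_mem i0 (mem_univ _)]
      · rw [coeff_X, if_pos rfl]
      · intro j _ hj
        rw [coeff_X, if_neg]
        intro h
        exact hj (Finsupp.single_left_injective one_ne_zero h)
    have hmem : Finsupp.single i0 1 ∈ (system n r none).support := by
      rw [mem_support_iff, hcoeff]; exact one_ne_zero
    refine le_trans ?_ (le_totalDegree hmem)
    simp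

/-- **Grigoriev 2001, Theorem (i)** (in the tree's static-SOS currency `HasSOSRefutation`, half-degree
`d`: squares of polynomials of degree `≤ d`, products of degree `≤ 2d`): for `2d ≤ n` and
`d − 1 < r < n − d + 1` the knapsack system `{Σ X_i = r, X_i² = X_i}` has NO static
Positivstellensatz refutation of half-degree `d`. With `d = k + 1`: "suppose that `k < r < n − k` …
the Positivstellensatz refutation degree of (0.7) is greater or equal to `2k + 4`" (Grigoriev's
range `0 ≤ k ≤ (n−3)/2`; here `2k + 2 ≤ n`). Tight by Lee–Prakash–de Wolf–Yuen, Thm. 4.3.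
[cite: Grigoriev2001, Theorem (i) (PDF p. 6) and its proof (PDF pp. 8–9)]
[cite: LeePrakashDewolfYuen2016, Thm. 4.2 / App. C Thm. C.1 (arXiv text chunks 14, 23)] -/
theorem not_hasSOSRefutation {d : ℕ} {r : ℝ} (hd : 2 * d ≤ n) (hn : 1 ≤ n)
    (hr₁ : (d : ℝ) - 1 < r) (hr₂ : r < (n : ℝ) - d + 1) :
    ¬ HasSOSRefutation (system n r) d := by
  refine not_hasSOSRefutation_of_functional' (functional n r) (by rw [functional_one]; exact one_pos)
    (fun q hq => functional_mul_self_nonneg hd hr₁ hr₂ hq) fun e g hdeg => ?_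
  cases e with
  | none =>
    rw [totalDegree_system_none hn] at hdeg
    rw [mul_comm]
    exact functional_knapsack_mul r (by omega)
  | some i =>
    rw [system_some, mul_comm]
    exact functional_bool_mul r i g

/-- **Grigoriev 2001, Theorem (i), printed parametrisation**: for an integer `k` with `2k + 2 ≤ n`
and `k < r < n − k`, the knapsack system has no static SOS refutation of half-degree `k + 1`
(i.e. every Positivstellensatz refutation has degree `≥ 2k + 4`).
[cite: Grigoriev2001, Theorem (i) (PDF p. 6)] -/
theorem not_hasSOSRefutation_succ {k : ℕ} {r : ℝ} (hk : 2 * k + 2 ≤ n) (hr₁ : (k : ℝ) < r)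
    (hr₂ : r < (n : ℝ) - k) : ¬ HasSOSRefutation (system n r) (k + 1) :=
  not_hasSOSRefutation (by omega) (by omega) (by push_cast; linarith) (by push_cast; linarith)

end Knapsack

end Literature.Computability.Complexity

end
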